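import Summits.ABC.IUTFork.Cor312ProvKIdeles
import Literature.IUT.LogVolume.GenuineSupportPrimesBound
import Literature.IUT.LogVolume.Theorem110TowerBridge
import Literature.IUT.HodgeTheaters.InitialThetaDataOfModelPlaces
import Literature.NumberTheory.DiophantineGeometry.AbcWave0UniformABCProofs
import HarnessLib

/-!
# Branch C «HEX-KERNEL», brick (H6): the places of the OPAQUE genuine Θ-volume datum over a DEEP prime are BAD
# (they lie in the Dupuy–Hilado bad set `S` of the `K`-level pilot datum `pilotDataOfK T.D T.K`)

PROOF-ONLY file (no `def`, no new `Prop`) of the abc-iut cell (seat abc-iut-w4-d098, gen 7; brick «H6» announced on STATUS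
2026-08-26 for abc-iut-C-cert-1's «HEX-KERNEL» assembly (H5) of `Conditional.not_hSH_v6K_of_exists_deep`, p438886).
TAKES NO SIDE on [IUTchIII] Cor. 3.12 or on any author.

WHY. The residual input `hex` of `Conditional.not_hSH_v6K_of_exists_deep` asks for an admissible `(P, l)`, a datum
`T : Cor22.ThetaVolumeDatumAt P l`, a prime `p`, a label and a place `x₀ | p` of `T.K` at which the CHOSEN realising q-idele
`(exists_realising_qIdeles_pilotDataOfK T.D).choose p x₀` is deep. By its `choose_spec` that idele is a UNIT (norm `1`) at
every place `x₀` OUTSIDE the bad set `(pilotDataOfK T.D T.K).S`; so brick (H4) «`‖t_q(x₀)‖ = 7^{−k/l}` at every `x₀ | 7`»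
needs, FIRST, that every place of `T.K` over `7` lies IN `S`. The datum `T` is opaque (a structure with free carriers
`F, K, F̄, E`), so this must come from its typed fields alone. It does:

* `T.j_eq : j(T.E) = j(λ)` in `T.F` ([IUTchIV] Cor. 2.2 (ii) proof p. 42: "the elliptic curve `E_F`" of `x_E = λ`), so
  `ord_x j(T.E) < 0` at every place `x` of `T.F` over a prime `p` at which `j(λ)` has a pole at EVERY place of `F_tpd`
  (`Cor22.ord_algebraMap_neg_iff`);
* `T.D.isSemistable` ([IUTchI] Def. 3.1 (b) "`X_F` … admits stable reduction over all `v ∈ 𝕍(F)^non`"), so `T.E` has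
  MULTIPLICATIVE reduction at such `x` (good reduction forces `ord_x j ≥ 0`: the tree's
  `Literature.IUT.HodgeTheaters.hasMultiplicativeReductionAt_of_ord_j_neg`, Silverman AEC VII.5.1);
* `T.isP5Choice` ([IUTchIV] Cor. 2.2 (ii) proof (P5), p. 46: "`𝕍^bad_mod :=` the nonarchimedean valuations … that do not
  divide `2l` and at which `E_F` has bad multiplicative reduction"): for `p ∉ {2, l}` such `x` lies in `𝕍(F)^bad`;
* `Cor312Prov.mem_pilotDataOfK_S_iff` (abc-iut-C-cert-3): the bad set of `pilotDataOfK T.D T.K` is the set of primes of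
  `T.K` over `𝕍(F)^bad`.

WHAT IS PROVED (all for an ARBITRARY datum / initial Θ-datum; classical bookkeeping, no engine):
* `Hex.natCast_mem_asIdeal_iff_residueChar_dvd` — `(n) ⊆ 𝔭_v ⟺ p_v ∣ n`;
* `Hex.mem_VFbad_of_ord_j_neg` — `F`-level: (P5) choice + semistable + `ord_x j(E_F) < 0` + `x ∤ 2l` ⟹ `x ∈ 𝕍(F)^bad`;
* `Hex.mem_pilotDataOfK_S_of_ord_j_neg` — `K`-level: the same for a prime `w` of `L ⊇ F` read at the place of `F` below;
* `Hex.placeOf_mem_S_of_forall_ord_jInv_neg` — DATUM level: for `T : Cor22.ThetaVolumeDatumAt P l`, a prime `p ≠ 2`,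
  `p ≠ l` with `ord_w j(λ) < 0` at EVERY place `w | p` of `F_tpd = P.F`, EVERY element `x₀` of the fibre of
  `𝕍(T.K) → 𝕍_ℚ` over `p` has `placeOf (pilotDataOfK T.D T.K) p x₀ ∈ (pilotDataOfK T.D T.K).S` — the exact membership
  the `choose_spec` of `Cor312Prov.exists_realising_qIdeles_pilotDataOfK` is guarded by;
* `Hex.residueChar_rat_eq_natGenerator`, `Hex.placeOf_mem_S_ratPoint` — the `ℚ`-rational form: for `P = ratPoint q`
  (`P.F = ℚ`) the hypothesis is `∀ v, natGenerator v = p → ord_v j(q) < 0`, verbatim the export shape of the tree's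
  `λ_k = 1/2 + 2/7^k` witnesses (`Cor22.exists_ratPoint_mem_std_two`, `Cor22.ord_jInv_lamSeven_neg`: `p = 7`).

HONEST FRAMING: statements about OUR typed objects; nothing here bears on the truth of [IUTchIII] Cor. 3.12 or of abc;
typed ≠ proved; instantiated ≠ endorsed. [claim: Mochizuki2012, status: disputed] for every IUT quotation.
[cite: Mochizuki2012, IUTchI Def. 3.1 (b) p. 61; IUTchIV Cor. 2.2 (ii) proof (P5) p. 46] [cite: DupuyHilado2025, §3.3, §3.4]
[cite: SilvermanAEC2009, VII.5 Prop. 5.1]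
-/

noncomputable section

open Set Function NumberField IsDedekindDomain

namespace Summit.ABC.IUTFork.Conditional.Hex

open Thm311 Thm311.Real Cor312Prov Literature.IUT.LogVolume Literature.IUT.HodgeTheaters
open Literature.NumberTheory.DiophantineGeometry Literature.NumberTheory.DiophantineGeometry.GenEll

/-! ## §1. Residue characteristics -/

section ResidueChar

variable {F : Type} [Field F]

/-- `(n) ⊆ 𝔭_v ⟺ p_v ∣ n` for a finite place `v` of a number field and `n : ℕ` (`𝔭_v ∩ ℤ = (p_v)`).
[cite: NeukirchANT1999, Ch. I (8.2)] -/
theorem natCast_mem_asIdeal_iff_residueChar_dvd (v : HeightOneSpectrum (𝓞 F)) (n : ℕ) :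
    ((n : ℕ) : 𝓞 F) ∈ v.asIdeal ↔ residueChar F v ∣ n := by
  have h : v.asIdeal.under ℤ = Ideal.span {(residueChar F v : ℤ)} :=
    (Ideal.LiesOver.over (p := Ideal.span {(residueChar F v : ℤ)}) (P := v.asIdeal)).symm
  have h1 : ((n : ℕ) : 𝓞 F) ∈ v.asIdeal ↔ ((n : ℕ) : ℤ) ∈ v.asIdeal.under ℤ := by
    rw [Ideal.under_def, Ideal.mem_comap, map_natCast]
  rw [h1, h, Ideal.mem_span_singleton, Int.natCast_dvd_natCast]

/-- Two distinct primes do not both lie in a finite place: if `p_v = p` then `(p') ⊄ 𝔭_v` for every prime `p' ≠ p`.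
[cite: NeukirchANT1999, Ch. I (8.2)] -/
theorem natCast_notMem_asIdeal_of_residueChar_eq (v : HeightOneSpectrum (𝓞 F)) {p p' : ℕ} (hp' : p'.Prime)
    (hv : residueChar F v = p) (hne : p' ≠ p) : ((p' : ℕ) : 𝓞 F) ∉ v.asIdeal := by
  intro hmem
  rw [natCast_mem_asIdeal_iff_residueChar_dvd, hv] at hmem
  have hp : p.Prime := hv ▸ residueChar_prime F v
  exact hne ((Nat.prime_dvd_prime_iff_eq hp hp').mp hmem).symm

/-- Over `ℚ`, the cell's residue characteristic `p_v` IS Mathlib's `Rat.HeightOneSpectrum.natGenerator v` (both are the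
prime with `𝔭_v = (p)`). [folklore] -/
theorem residueChar_rat_eq_natGenerator (v : HeightOneSpectrum (𝓞 ℚ)) :
    residueChar ℚ v = Rat.HeightOneSpectrum.natGenerator v := by
  have hmem : ((Rat.HeightOneSpectrum.natGenerator v : ℕ) : 𝓞 ℚ) ∈ v.asIdeal :=
    (UniformABCConjecture.natCast_mem_asIdeal_iff v _).mpr dvd_rfl
  rw [natCast_mem_asIdeal_iff_residueChar_dvd] at hmem
  exact (Nat.prime_dvd_prime_iff_eq (residueChar_prime ℚ v) (Rat.HeightOneSpectrum.prime_natGenerator v)).mp hmem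

end ResidueChar

/-! ## §2. `F`-level and `K`-level: a semistable curve with `ord_x j < 0`, `x ∤ 2l`, has `x ∈ 𝕍(F)^bad` under the (P5) choice -/

section Datum

variable {F K Fbar : Type} [Field F] [NumberField F] [Field K] [NumberField K] [Algebra F K] [Field Fbar]
  [Algebra F Fbar] [Algebra K Fbar] {E : WeierstrassCurve F} [E.IsElliptic] {l : ℕ} {Pb : BadPlacePredicates K}
  (D : InitialThetaData F K Fbar E l Pb)

/-- **`F`-level.** For an initial Θ-datum `D` whose `𝕍^bad_mod` is the (P5) choice: a finite place `x` of `F` with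
`ord_x j(E_F) < 0` and `x ∤ 2`, `x ∤ l` lies in `𝕍(F)^bad` — semistability ([IUTchI] Def. 3.1 (b)) makes the reduction at
`x` multiplicative, and (P5) ([IUTchIV] Cor. 2.2 (ii) proof p. 46) puts every such place over `𝕍^bad_mod`.
[cite: Mochizuki2012, IUTchI Def. 3.1 (b) p. 61; IUTchIV Cor. 2.2 (ii) proof (P5) p. 46] -/
theorem mem_VFbad_of_ord_j_neg (hP5 : ThetaData.IsP5Choice D) (x : HeightOneSpectrum (𝓞 F))
    (hord : ord F x E.j < 0) (h2 : ((2 : ℕ) : 𝓞 F) ∉ x.asIdeal) (hl : ((l : ℕ) : 𝓞 F) ∉ x.asIdeal) :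
    FinitePlace.mk x ∈ D.VFbad := by
  refine (hP5 (FinitePlace.mk x)).mpr ?_
  rw [FinitePlace.maximalIdeal_mk]
  refine ⟨fun p hp => ?_, hasMultiplicativeReductionAt_of_ord_j_neg E D.isSemistable hord⟩
  rcases Finset.mem_insert.mp hp with rfl | hp
  · exact h2
  · rw [Finset.mem_singleton] at hp
    subst hp
    exact hl

/-- **`K`-level.** For a finite extension `L ⊇ F` and a prime `w` of `L`: if the place `x` of `F` below `w` has
`ord_x j(E_F) < 0`, `x ∤ 2`, `x ∤ l`, then `w` lies in the bad set `S` of the `L`-level Dupuy–Hilado pilot datum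
`pilotDataOfK D L` (= the primes of `L` over `𝕍(F)^bad`, abc-iut-C-cert-3's `mem_pilotDataOfK_S_iff`).
[cite: Mochizuki2012, IUTchI Def. 3.1 (b) p. 61; IUTchIV Cor. 2.2 (ii) proof (P5) p. 46] [cite: DupuyHilado2025, §3.3] -/
theorem mem_pilotDataOfK_S_of_ord_j_neg (hP5 : ThetaData.IsP5Choice D) (L : Type) [Field L] [NumberField L] [Algebra F L]
    (w : HeightOneSpectrum (𝓞 L)) (hord : ord F (finBelow F L w) E.j < 0)
    (h2 : ((2 : ℕ) : 𝓞 F) ∉ (finBelow F L w).asIdeal) (hl : ((l : ℕ) : 𝓞 F) ∉ (finBelow F L w).asIdeal) :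
    w ∈ (pilotDataOfK D L).S :=
  (mem_pilotDataOfK_S_iff D L w).mpr (mem_VFbad_of_ord_j_neg D hP5 (finBelow F L w) hord h2 hl)

/-- **`K`-level, residue-characteristic form.** If `p ≠ 2`, `p ≠ l` is the residue characteristic of `w` and
`ord_x j(E_F) < 0` at the place `x` of `F` below `w`, then `w ∈ (pilotDataOfK D L).S`.
[cite: Mochizuki2012, IUTchIV Cor. 2.2 (ii) proof (P5) p. 46] -/
theorem mem_pilotDataOfK_S_of_residueChar (hP5 : ThetaData.IsP5Choice D) (L : Type) [Field L] [NumberField L]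
    [Algebra F L] (w : HeightOneSpectrum (𝓞 L)) {p : ℕ} (hp2 : p ≠ 2) (hpl : p ≠ l) (hw : residueChar L w = p)
    (hord : ord F (finBelow F L w) E.j < 0) : w ∈ (pilotDataOfK D L).S := by
  have hx : residueChar F (finBelow F L w) = p := by rw [residueChar_finBelow, hw]
  exact mem_pilotDataOfK_S_of_ord_j_neg D hP5 L w hord
    (natCast_notMem_asIdeal_of_residueChar_eq _ Nat.prime_two hx hp2.symm)
    (natCast_notMem_asIdeal_of_residueChar_eq _ D.l_prime hx (Ne.symm hpl))

end Datum

/-! ## §3. DATUM level: every place of `T.K` over a deep prime of `λ` is in the bad set of `pilotDataOfK T.D T.K` -/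

section Point

variable {P : NFPoint} {l : ℕ}

/-- **(H6) at a genuine Θ-volume datum.** Let `T : Cor22.ThetaVolumeDatumAt P l` (opaque), `p` a prime with `p ≠ 2`,
`p ≠ l`, such that `j(λ)` has a pole at EVERY place of `F_tpd = P.F` over `p`. Then for every prime `w` of `T.K` of
residue characteristic `p`: `w ∈ (pilotDataOfK T.D T.K).S`. (Chain: `T.j_eq` ⟹ `ord j(T.E) < 0` at the place of `T.F`
below `w` ⟹ multiplicative by `T.D.isSemistable` ⟹ in `𝕍(F)^bad` by `T.isP5Choice` ⟹ `w ∈ S`.)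
[cite: Mochizuki2012, IUTchI Def. 3.1 (b) p. 61; IUTchIV Cor. 2.2 (ii) proof (P5) p. 46] -/
theorem mem_S_of_forall_ord_jInv_neg (T : Cor22.ThetaVolumeDatumAt P l) {p : ℕ} (hp2 : p ≠ 2) (hpl : p ≠ l)
    (hordP : ∀ w : HeightOneSpectrum (𝓞 P.F), residueChar P.F w = p → ord P.F w (Cor22.jInv P.x) < 0) :
    letI := T.instFieldF; letI := T.instNumberFieldF; letI := T.instAlgebraF; letI := T.instFieldK
    letI := T.instNumberFieldK; letI := T.instAlgebraK; letI := T.instFieldFbar; letI := T.instAlgebraFbar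
    letI := T.instAlgebraKFbar; letI := T.instIsElliptic
    ∀ w : HeightOneSpectrum (𝓞 T.K), residueChar T.K w = p → w ∈ (pilotDataOfK T.D T.K).S := by
  letI := T.instFieldF; letI := T.instNumberFieldF; letI := T.instAlgebraF; letI := T.instFieldK
  letI := T.instNumberFieldK; letI := T.instAlgebraK; letI := T.instFieldFbar; letI := T.instAlgebraFbar
  letI := T.instAlgebraKFbar; letI := T.instIsElliptic
  intro w hw
  refine mem_pilotDataOfK_S_of_residueChar T.D T.isP5Choice T.K w hp2 hpl hw ?_
  -- `ord j(T.E) < 0` at the place `x` of `T.F` below `w`, read from `ord j(λ) < 0` at the place of `F_tpd` below `x`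
  set x := finBelow T.F T.K w with hx
  have hres : residueChar P.F (finBelow P.F T.F x) = p := by
    rw [residueChar_finBelow, hx, residueChar_finBelow, hw]
  rw [T.j_eq]
  exact (Cor22.ord_algebraMap_neg_iff x (Cor22.jInv P.x)).mpr (hordP _ hres)

/-- **(H6) in fibre form** — the exact guard of the `choose_spec` of `Cor312Prov.exists_realising_qIdeles_pilotDataOfK`:
for `T`, `p ≠ 2`, `p ≠ l` as above and EVERY element `x₀` of the fibre of `𝕍(T.K) → 𝕍_ℚ` over `p`,
`placeOf (pilotDataOfK T.D T.K) p x₀ ∈ (pilotDataOfK T.D T.K).S` (so the chosen realising q-idele at `x₀` is NOT forced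
to be a unit there: its norm is `exp(−P_q(x₀)·log N(x₀)/n_{x₀})` with `P_q(x₀) = ord_{x₀}(q)/2l > 0`).
[cite: Mochizuki2012, IUTchIV Cor. 2.2 (ii) proof (P5) p. 46] [cite: DupuyHilado2025, §3.4] -/
theorem placeOf_mem_S_of_forall_ord_jInv_neg (T : Cor22.ThetaVolumeDatumAt P l) (pp : Nat.Primes)
    (hp2 : (pp : ℕ) ≠ 2) (hpl : (pp : ℕ) ≠ l)
    (hordP : ∀ w : HeightOneSpectrum (𝓞 P.F), residueChar P.F w = pp → ord P.F w (Cor22.jInv P.x) < 0) :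
    letI := T.instFieldF; letI := T.instNumberFieldF; letI := T.instAlgebraF; letI := T.instFieldK
    letI := T.instNumberFieldK; letI := T.instAlgebraK; letI := T.instFieldFbar; letI := T.instAlgebraFbar
    letI := T.instAlgebraKFbar; letI := T.instIsElliptic
    ∀ x₀ : (thetaIndex (pilotDataOfK T.D T.K)).Fibre (.inr pp),
      haveI : Fact (pp : ℕ).Prime := ⟨pp.2⟩
      placeOf (pilotDataOfK T.D T.K) pp.1 x₀ ∈ (pilotDataOfK T.D T.K).S := by
  letI := T.instFieldF; letI := T.instNumberFieldF; letI := T.instAlgebraF; letI := T.instFieldK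
  letI := T.instNumberFieldK; letI := T.instAlgebraK; letI := T.instFieldFbar; letI := T.instAlgebraFbar
  letI := T.instAlgebraKFbar; letI := T.instIsElliptic
  intro x₀
  haveI : Fact (pp : ℕ).Prime := ⟨pp.2⟩
  exact mem_S_of_forall_ord_jInv_neg T hp2 hpl hordP _
    ((mem_placesOver_iff_residueChar _).mp (placeOf_mem (pilotDataOfK T.D T.K) pp.1 x₀))

/-- **(H6) for a `ℚ`-rational point**, in the export currency of the tree's `λ_k = 1/2 + 2/7^k` witnesses
(`Cor22.exists_ratPoint_mem_std_two`, `Cor22.ord_jInv_lamSeven_neg`: `∀ v, natGenerator v = 7 → ord_v j(λ_k) < 0`): for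
`P = ratPoint q`, a prime `p ≠ 2`, `p ≠ l` with `ord_v j(q) < 0` at the place `v = (p)` of `ℚ`, every element `x₀` of the
fibre of `𝕍(T.K)` over `p` has `placeOf (pilotDataOfK T.D T.K) p x₀ ∈ (pilotDataOfK T.D T.K).S`.
[cite: Mochizuki2012, IUTchIV Cor. 2.2 (ii) proof (P5) p. 46] [cite: MochizukiGenEll2010, Ex 1.3 (i) p.5] -/
theorem placeOf_mem_S_ratPoint {q : ℚ} (T : Cor22.ThetaVolumeDatumAt (ratPoint q) l) (pp : Nat.Primes)
    (hp2 : (pp : ℕ) ≠ 2) (hpl : (pp : ℕ) ≠ l)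
    (hneg : ∀ v : HeightOneSpectrum (𝓞 ℚ), Rat.HeightOneSpectrum.natGenerator v = pp → ord ℚ v (Cor22.jInv q) < 0) :
    letI := T.instFieldF; letI := T.instNumberFieldF; letI := T.instAlgebraF; letI := T.instFieldK
    letI := T.instNumberFieldK; letI := T.instAlgebraK; letI := T.instFieldFbar; letI := T.instAlgebraFbar
    letI := T.instAlgebraKFbar; letI := T.instIsElliptic
    ∀ x₀ : (thetaIndex (pilotDataOfK T.D T.K)).Fibre (.inr pp),
      haveI : Fact (pp : ℕ).Prime := ⟨pp.2⟩
      placeOf (pilotDataOfK T.D T.K) pp.1 x₀ ∈ (pilotDataOfK T.D T.K).S :=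
  placeOf_mem_S_of_forall_ord_jInv_neg T pp hp2 hpl fun v hv =>
    hneg v (by rw [← residueChar_rat_eq_natGenerator v]; exact hv)

/-- **(H6) at the deep prime `7` of the `λ_k`-family**, for every prime `l ≠ 7` (e.g. every admissible `l ≥ 11`): at a
genuine Θ-volume datum `T` over `P = ratPoint q` with `ord_{(7)} j(q) < 0` (the `λ_k = 1/2 + 2/7^k` of
`Cor22.exists_ratPoint_mem_std_two` / `Cor22.ord_jInv_lamSeven_neg`), EVERY place of `T.K` over `7` is in the bad set
of `pilotDataOfK T.D T.K`. [cite: Mochizuki2012, IUTchIV Cor. 2.2 (ii) proof (P5) p. 46] [cite: MochizukiGenEll2010, Ex 1.3 (i) p.5] -/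
theorem placeOf_mem_S_ratPoint_seven {q : ℚ} (T : Cor22.ThetaVolumeDatumAt (ratPoint q) l) (hl7 : l ≠ 7)
    (hneg : ∀ v : HeightOneSpectrum (𝓞 ℚ), Rat.HeightOneSpectrum.natGenerator v = 7 → ord ℚ v (Cor22.jInv q) < 0) :
    letI := T.instFieldF; letI := T.instNumberFieldF; letI := T.instAlgebraF; letI := T.instFieldK
    letI := T.instNumberFieldK; letI := T.instAlgebraK; letI := T.instFieldFbar; letI := T.instAlgebraFbar
    letI := T.instAlgebraKFbar; letI := T.instIsElliptic
    ∀ x₀ : (thetaIndex (pilotDataOfK T.D T.K)).Fibre (.inr ⟨7, by norm_num⟩),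
      haveI : Fact (Nat.Prime 7) := ⟨by norm_num⟩
      placeOf (pilotDataOfK T.D T.K) 7 x₀ ∈ (pilotDataOfK T.D T.K).S :=
  placeOf_mem_S_ratPoint T ⟨7, by norm_num⟩ (by norm_num) (Ne.symm hl7) hneg

end Point

end Summit.ABC.IUTFork.Conditional.Hex

end
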